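import Summits.AtomisticToContinuum.HydrodynamicLimit.Theses.GolfBallDice
import HarnessLib

/-!
# Crux `KernelGasEulerLimit` (stmt-AtomisticToContinuum-17361) — birth skeleton (BC3), line `birth`

Route `route-AtomisticToContinuum-GolfBallDice`, sub-problem `HydrodynamicLimit`; crux decl
`Summit.AtomisticToContinuum.HydrodynamicLimit.Theses.GolfBallDice.KernelGasEulerLimit` (rank 4, XL): the
packing-guarded Euler limit of the gapped, flux-reciprocal kernel gas `HS(κ_N)` at fixed reduced density —
LLN of the χ-tested density / momentum / energy fields under `Q N t = kernelGasLawAt (κ N) … t` at every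
pre-shock time `t`, given the LLN at `t = 0`.

## The cut registered here: the Olla–Varadhan–Yau relative-entropy architecture, four stubs

The crux is cut along the seams of OllaVaradhanYau1993 (Thm 2.1 = entropy propagation, Cor 2.2 = entropy ⇒
law of large numbers), with the REFERENCE local Gibbs family made EXPLICIT: at time `t` it is the flow-free
sphere local Gibbs law `R N t = Z⁻¹ 𝟙_D ∏ᵢ a_t(xᵢ) M_{1,u_t(xᵢ),θ_t(xᵢ)}(vᵢ) dz` whose activity is the
equation-of-state activity of the Euler density,
`a_t(x) = ρ_t(x) · exp(f_ex(ρ_t(x)σ³) + Z(ρ_t(x)σ³) − 1)` (`hsExcessFreeEnergy`, `hsCompressibility`: the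
excess chemical potential `μ_ex = f_ex + η f_ex' = f_ex + Z − 1`, i.e. the Euler–Lagrange equation of the
dilute hard-sphere free-energy functional; constants are immaterial in the canonical ensemble). No `∃ a`,
no inverse statics hidden in any stub.

* `stub_diluteReferenceLD` (S · STATICS, size L) — dilute local-equilibrium dictionary ALONG a normalised
  classical hard-sphere-Euler solution in the packing band: for `∫ρ₀ = 1`, `0 < σ ≤ 1/2`, every `t ∈ [0,T)`
  the reference laws `R N t` are probability measures and their χ-tested density / momentum / energy fields
  concentrate EXPONENTIALLY (`≤ C e^{-(N+1)/C}`) around `(ρ_t, ρ_t u_t, E_t)`. Content: mass conservation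
  of the Euler solution, low-density cluster expansion / strict convexity of the hard-sphere free energy in
  the band (this is where the packing guard `ρσ³ < η₀` is used), canonical-ensemble large deviations,
  Gaussian velocity concentration. Dynamics- and kernel-free.
* `stub_initialEntropy` (I · STATICS, size M–L) — entropic identification of the initial datum: if under
  the time-0 law `Q N 0` (= the sphere local Gibbs law with the given profiles `(a₀,u₀,θ₀)`, up to the null
  contact set) the fields converge in probability to `(ρ₀, ρ₀u₀', E₀)` of the Euler datum, then the
  specific relative entropy `klDiv (Q N 0) (R N 0) / (N+1) → 0` (in fact the two canonical laws coincide: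
  `u₀ = u₀'`, `θ₀ = θ₀'`, `a₀ ∝ a_EOS(ρ₀)` by the variational characterisation of the LLN density).
* `stub_kernelEntropyGronwall` (D · DYNAMICS, size XL, the HARDEST and load-bearing stub) — OVY's Theorem
  2.1 transplanted to the contact-randomised hard-sphere gas: for outgoing-supported, flux-reciprocal Markov
  kernels with a uniform one-collision `L²(flux)` gap in the window `q_N (N+1)^{1/3} → ∞`, along a normalised
  Euler solution in the packing band, `klDiv (Q N 0) (R N 0) = o(N)` propagates to
  `klDiv (Q N t) (R N t) = o(N)` for every `t ∈ [0,T)`. Inside: well-posedness and Gibbs invariance of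
  `HS(κ)` (flux reciprocity), the entropy-production bound, the one/two-block ergodic step with noise living
  only on the contact boundary, the cubic energy current with true kinetic energy (the open inputs named in
  the crux's "why it might fail"; barriers BoltzmannHypothesis / MacroErgodicity / HighMomentumCutoffNarrow
  bite HERE and only here).
* `stub_entropyConcentrationTransfer` (T · INFORMATION THEORY, size M, provable now) — the entropy
  inequality in sequence form: finite `μ_N`, probability `ν_N`, `klDiv μ_N ν_N = o(N)` and
  `ν_N(A_N) ≤ C e^{-(N+1)/C}` give `μ_N(A_N) → 0` (Csiszár / Donsker–Varadhan:
  `μ(A) ≤ (H(μ|ν) + m log 2)/log(1 + 1/ν(A))` after normalising the mass `m = μ(univ) = O(H) + O(1)`).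

`KernelGasEulerLimit_of` is the sorry-free composition (≈ 60 lines of real logic + two measure-theoretic
helper lemmas): thresholds `η₀ := min ηS (min ηI ηD)`, `σ₀ := min (1/2) (min σI σD)`; CASE `∫ρ₀ = 1`: S gives
the reference laws (probability + exponential concentration) at `t`, I the initial entropy, D the entropy at
`t`, T the three LLN statements; CASE `∫ρ₀ ≠ 1`: testing the initial LLN against `χ ≡ 1`
(`empiricalDensityField_one`) forces the total mass of `Q N 0` to vanish, and by measurability of the
`HS(κ)` time maps on the torus (`ε_N ≤ σ < 1/2`) every `Q N t (A)` is bounded by that mass. The hypotheses of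
`KernelGasEulerLimit_of` are the name-keyed aliases `Registered.stub_*` (abbrevs defined as `type_of%` the
stub theorems, so alias = statement by construction). Sorries: exactly four, one inside each `stub_*`.
TYPING NOTE: the laws `Q` (kernel gas from the sphere local Gibbs law) and `R` (EOS reference) enter each stub as
universally quantified binders pinned by equations `Q = (fun N t => …) → R = (fun N t => …) →` instead of
`let … := …` (the registrar truncates a registered signature at its first `:=`); a prover restating a stub just
does `intro Q R hQ hR; subst hQ hR`, and the composition passes `_ _ rfl rfl`.

Disproof used: none on file (`ledger crux ls stmt-AtomisticToContinuum-17361`: no workfiles, no Negative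
lemmas; `ledger negatives --problem AtomisticToContinuum`: 20 entries, none a relative-entropy / local-Gibbs
large-deviation / kernel-gas statement). Evidence honoured: the refuter's Rev5Check / LambertWitness /
ExchangeKernel notes (the GAP clause is load-bearing — it enters only stub D, as it should).
-/

namespace Summit.AtomisticToContinuum.HydrodynamicLimit.Cruxes.KernelGasEulerLimit.Birth

open scoped BigOperators Topology ENNReal
open Filter Set MeasureTheory

/-- STUB S · DILUTE REFERENCE LARGE DEVIATIONS (statics; size L). Along a classical hard-sphere-Euler
solution on `[0,T)` with normalised mass `∫ρ₀ = 1`, reduced diameter `0 < σ ≤ 1/2` and local packing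
fraction `ρ_t(x)σ³ < η₀`, the flow-free sphere local Gibbs laws `R N t` with the EQUATION-OF-STATE ACTIVITY
`a_t = ρ_t exp(f_ex(ρ_tσ³) + Z(ρ_tσ³) − 1)`, velocity `u_t` and temperature `θ_t` are probability measures and
their χ-tested empirical density / momentum / energy fields concentrate exponentially around
`(ρ_t, ρ_t u_t, ρ_t(|u_t|²/2 + 3θ_t/2))`. Why plausibly true: low-density cluster expansion (virial series
analytic, free energy strictly convex in the band), canonical large deviations with a unique minimiser, mass
conservation `∫ρ_t = 1`, Gaussian velocities. Why it might fail: only through the typing — the band must sit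
inside the convergence radius of the Mayer series uniformly (the prover chooses `η₀`), and `hsCompressibility`
must be the true `Z` there (it is: `f_ex` is analytic in the band, no `deriv` junk). Leans on:
`IsHardSphereEulerSolution`, `liouville`, `canonicalDensity`, `localGibbsProfile`, `hsExcessFreeEnergy`,
`hsCompressibility`, `empirical*Field`, `totalEnergyDensity`. Sources: Spohn1991 Part I §2.3–§3,
Ruelle1969 §3.4 / §4, OllaVaradhanYau1993 §3, KipnisLandim1999 App. 2. -/
theorem stub_diluteReferenceLD :
    ∃ η₀ : ℝ, 0 < η₀ ∧ ∀ (σ T : ℝ) (ρ θ : ℝ → Literature.MathematicalPhysics.KineticTheory.T3 → ℝ) (u : ℝ → Literature.MathematicalPhysics.KineticTheory.T3 → Literature.MathematicalPhysics.KineticTheory.V3), 0 < σ → σ ≤ 1 / 2 → Literature.MathematicalPhysics.KineticTheory.IsHardSphereEulerSolution σ T ρ u θ → (∀ t ∈ Set.Ico 0 T, ∀ x, ρ t x * σ ^ 3 < η₀) → (∫ x, ρ 0 x = 1) → ∀ R : (N : ℕ) → ℝ → MeasureTheory.Measure (Literature.Analysis.FluidPDE.Config (N + 1) (Fin 3) Literature.MathematicalPhysics.KineticTheory.T3),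 R = (fun N t => (Literature.Analysis.FluidPDE.liouville (Literature.Analysis.FluidPDE.Torus.geometry (Fin 3)) (N + 1) (Literature.MathematicalPhysics.KineticTheory.hsDiameter σ N)).withDensity (fun z => ENNReal.ofReal (Literature.Analysis.FluidPDE.canonicalDensity (Literature.Analysis.FluidPDE.Torus.geometry (Fin 3)) (Literature.MathematicalPhysics.KineticTheory.hsDiameter σ N) (N + 1) (Literature.MathematicalPhysics.KineticTheory.localGibbsProfile (fun x => ρ t x * Real.exp (Literature.MathematicalPhysics.KineticTheory.hsExcessFreeEnergy (ρ t x * σ ^ 3) + Literature.MathematicalPhysics.KineticTheory.hsCompressibility (ρ t x * σ ^ 3) - 1)) (u t) (θ t)) z))) → ∀ t ∈ Set.Ico 0 T, (∀ N, MeasureTheory.IsProbabilityMeasure (R N t)) ∧ ∀ χ : Literature.MathematicalPhysics.KineticTheory.T3 → ℝ, Continuous χ → ∀ δ : ℝ, 0 < δ → ∃ C : ℝ, 0 < C ∧ ∀ N : ℕ, R N t {z | δ < |Literature.MathematicalPhysics.KineticTheory.empiricalDensityField z χ - ∫ x, χ x * ρ t x|} ≤ ENNReal.ofReal (C * Real.exp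 (-(C⁻¹ * ((N : ℝ) + 1)))) ∧ R N t {z | δ < ‖Literature.MathematicalPhysics.KineticTheory.empiricalMomentumField z χ - ∫ x, (χ x * ρ t x) • u t x‖} ≤ ENNReal.ofReal (C * Real.exp (-(C⁻¹ * ((N : ℝ) + 1)))) ∧ R N t {z | δ < |Literature.MathematicalPhysics.KineticTheory.empiricalEnergyField z χ - ∫ x, χ x * Literature.MathematicalPhysics.KineticTheory.totalEnergyDensity (ρ t x) (u t x) (θ t x)|} ≤ ENNReal.ofReal (C * Real.exp (-(C⁻¹ * ((N : ℝ) + 1)))) := by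
  sorry

/-- STUB I · ENTROPIC IDENTIFICATION OF THE INITIAL DATUM (statics; size M–L). For Markov collision
kernels `κ_N` (no further hypothesis: only time `0` is involved, where `kernelGasLawAt … 0` is the initial
sphere local Gibbs law up to the Liouville-null contact set), continuous positive profiles `(a₀, u₀, θ₀)` and
`σ` small: if a classical hard-sphere-Euler solution on `[0,T)`, `T > 0`, with `ρ₀σ³ < η₀`, has its datum
`(ρ₀, ρ₀u₀', E₀)` as the limit in probability of the χ-tested fields under `Q N 0`, then the specific
relative entropy of `Q N 0` with respect to the equation-of-state reference law `R N 0` (activity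
`ρ₀ e^{f_ex + Z − 1}`, velocity `u 0`, temperature `θ 0`) vanishes: `klDiv (Q N 0) (R N 0) / (N+1) → 0`.
Why plausibly true: uniqueness of limits in probability identifies `u₀' = u₀`, `θ₀' = θ₀` and the LLN
density of `a₀`; the variational (Gibbs / large-deviation) characterisation of that density gives
`a₀ = c · a_EOS(ρ₀)`, and constants drop out of the canonical law, so `Q N 0 = R N 0`. Why it might fail:
only if the local-density approximation failed at fixed reduced density (it does not in the dilute band:
interaction range `ε_N → 0` macroscopically). Leans on: `kernelGasLawAt`, `liouville`, `canonicalDensity`,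
`localGibbsProfile`, `InformationTheory.klDiv`, `localGibbs_lln` (HardSphereEuler), HardSphereEulerProofs
(`isProbabilityMeasure_localGibbsMeasure`, σ ≤ 1/2). Sources: OllaVaradhanYau1993 §3, Spohn1991 Part I §2.3,
KipnisLandim1999 App. 1–2. -/
theorem stub_initialEntropy :
    ∃ η₀ : ℝ, 0 < η₀ ∧ ∀ (κ : ℕ → Literature.MathematicalPhysics.KineticTheory.CollisionKernel (Fin 3)) [∀ N, ProbabilityTheory.IsMarkovKernel (κ N)] (a₀ θ₀ : Literature.MathematicalPhysics.KineticTheory.T3 → ℝ) (u₀ : Literature.MathematicalPhysics.KineticTheory.T3 → Literature.MathematicalPhysics.KineticTheory.V3), Continuous a₀ → Continuous θ₀ → Continuous u₀ → (∀ x, 0 < a₀ x) → (∀ x, 0 < θ₀ x) → ∃ σ₀ : ℝ, 0 < σ₀ ∧ ∀ σ : ℝ, 0 < σ → σ < σ₀ → ∀ (T : ℝ) (ρ θ : ℝ → Literature.MathematicalPhysics.KineticTheory.T3 → ℝ) (u : ℝ → Literature.MathematicalPhysics.KineticTheory.T3 → Literature.MathematicalPhysics.KineticTheory.V3), Literature.MathematicalPhysics.KineticTheory.IsHardSphereEulerSolution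 σ T ρ u θ → 0 < T → (∀ x, ρ 0 x * σ ^ 3 < η₀) → ∀ (Q R : (N : ℕ) → ℝ → MeasureTheory.Measure (Literature.Analysis.FluidPDE.Config (N + 1) (Fin 3) Literature.MathematicalPhysics.KineticTheory.T3)), Q = (fun N t => Literature.MathematicalPhysics.KineticTheory.kernelGasLawAt (κ N) (Literature.Analysis.FluidPDE.Torus.geometry (Fin 3)) (Literature.MathematicalPhysics.KineticTheory.hsDiameter σ N) (N + 1) ((Literature.Analysis.FluidPDE.liouville (Literature.Analysis.FluidPDE.Torus.geometry (Fin 3)) (N + 1) (Literature.MathematicalPhysics.KineticTheory.hsDiameter σ N)).withDensity (fun z => ENNReal.ofReal (Literature.Analysis.FluidPDE.canonicalDensity (Literature.Analysis.FluidPDE.Torus.geometry (Fin 3)) (Literature.MathematicalPhysics.KineticTheory.hsDiameter σ N) (N + 1) (Literature.MathematicalPhysics.KineticTheory.localGibbsProfile a₀ u₀ θ₀) z))) t) → R = (fun N t => (Literature.Analysis.FluidPDE.liouville (Literature.Analysis.FluidPDE.Torus.geometry (Fin 3)) (N + 1) (Literature.MathematicalPhysics.KineticTheory.hsDiameter σ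 N)).withDensity (fun z => ENNReal.ofReal (Literature.Analysis.FluidPDE.canonicalDensity (Literature.Analysis.FluidPDE.Torus.geometry (Fin 3)) (Literature.MathematicalPhysics.KineticTheory.hsDiameter σ N) (N + 1) (Literature.MathematicalPhysics.KineticTheory.localGibbsProfile (fun x => ρ t x * Real.exp (Literature.MathematicalPhysics.KineticTheory.hsExcessFreeEnergy (ρ t x * σ ^ 3) + Literature.MathematicalPhysics.KineticTheory.hsCompressibility (ρ t x * σ ^ 3) - 1)) (u t) (θ t)) z))) → (∀ χ : Literature.MathematicalPhysics.KineticTheory.T3 → ℝ, Continuous χ → ∀ δ > (0 : ℝ), Filter.Tendsto (fun N => Q N 0 {z | δ < |Literature.MathematicalPhysics.KineticTheory.empiricalDensityField z χ - ∫ x, χ x * ρ 0 x|}) Filter.atTop (nhds 0) ∧ Filter.Tendsto (fun N => Q N 0 {z | δ < ‖Literature.MathematicalPhysics.KineticTheory.empiricalMomentumField z χ - ∫ x, (χ x * ρ 0 x) • u 0 x‖}) Filter.atTop (nhds 0) ∧ Filter.Tendsto (fun N => Q N 0 {z | δ < |Literature.MathematicalPhysics.KineticTheory.empiricalEnergyField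 z χ - ∫ x, χ x * Literature.MathematicalPhysics.KineticTheory.totalEnergyDensity (ρ 0 x) (u 0 x) (θ 0 x)|}) Filter.atTop (nhds 0)) → Filter.Tendsto (fun N : ℕ => InformationTheory.klDiv (Q N 0) (R N 0) / ((N : ENNReal) + 1)) Filter.atTop (nhds 0) := by
  sorry

/-- STUB D · KERNEL-GAS ENTROPY GRONWALL — OVY's Theorem 2.1 for `HS(κ)` (dynamics; size XL; the hardest,
load-bearing stub). For every sequence of Markov collision kernels `κ_N` that are outgoing-supported and
flux-reciprocal with a uniform one-collision `L²(flux)` spectral gap `q_N ∈ (0,1]` in the window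
`q_N (N+1)^{1/3} → ∞` (verbatim the crux's kernel prefix) there is a packing threshold `η₀ > 0` such that for
all continuous positive profiles, `∃ σ₀ ∀ σ ∈ (0,σ₀)`, for every classical hard-sphere-Euler solution on
`[0,T)` with `ρ_tσ³ < η₀` and `∫ρ₀ = 1`: if the specific relative entropy of the time-0 law `Q N 0` with
respect to the equation-of-state reference law `R N 0` is `o(1)`, then so is that of `Q N t` with respect
to `R N t`, for every `t ∈ [0,T)`. Why plausibly true: this is the relative-entropy method (Yau 1991,
OllaVaradhanYau1993 Thm 2.1) with the explicit local Gibbs reference dual to the Euler solution; flux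
reciprocity makes the hard-core Gibbs laws invariant and the Gibbs expectation of the contact momentum /
energy transfer equal to the specular one, so `∂_t H(Q_t|R_t) ≤ C H(Q_t|R_t) + o(N)` reduces to the usual
one-block / two-block step, now driven by `q_N(N+1)^{1/3} → ∞` kernel redraws per particle per unit time.
Why it might fail (= the crux's): OVY's ergodic step used BULK exchange noise on all near pairs, here the
noise charges only the collision boundary (zero contact Dirichlet form ⇒ kernel-invariant traces must
reach Gibbs through free flight — unproved), and the cubic energy current with true kinetic energy needs
Gaussian velocity tails along `HS(κ)` (HighMomentumCutoffBarrierNarrow). Leans on: `kernelGasLawAt`,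
`CollisionKernel`, `fluxIn`/`fluxOut`, `IsOutgoingSupported`, `IsFluxReciprocal`, `liouville`,
`canonicalDensity`, `localGibbsProfile`, `hsExcessFreeEnergy`, `hsCompressibility`,
`IsHardSphereEulerSolution`, `InformationTheory.klDiv`. Sources: OllaVaradhanYau1993 Thm 2.1,
LiveraniOlla1996, FritzFunakiLebowitz1994, Rezakhanlou2003, CometsEtAl2008, CookFeres2012. -/
theorem stub_kernelEntropyGronwall :
    ∀ (κ : ℕ → Literature.MathematicalPhysics.KineticTheory.CollisionKernel (Fin 3)) [∀ N, ProbabilityTheory.IsMarkovKernel (κ N)] (q : ℕ → ℝ), ((∀ N, Literature.MathematicalPhysics.KineticTheory.IsOutgoingSupported (κ N)) ∧ (∀ N, Literature.MathematicalPhysics.KineticTheory.IsFluxReciprocal (κ N)) ∧ (∀ N, 0 < q N ∧ q N ≤ 1) ∧ (∀ N (ω : Literature.MathematicalPhysics.KineticTheory.V3), ‖ω‖ = 1 → ∀ f : Literature.MathematicalPhysics.KineticTheory.V3 → ℝ, Measurable f → (∀ n, |f n| ≤ 1) → ∫ n, f n ∂(Literature.MathematicalPhysics.KineticTheory.fluxOut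 ω) = 0 → ∫ g, (∫ n, f n ∂((κ N) (ω, g))) ^ 2 ∂(Literature.MathematicalPhysics.KineticTheory.fluxIn ω) ≤ (1 - q N) * ∫ n, (f n) ^ 2 ∂(Literature.MathematicalPhysics.KineticTheory.fluxOut ω)) ∧ Filter.Tendsto (fun N : ℕ => q N * ((N : ℝ) + 1) ^ (1 / 3 : ℝ)) Filter.atTop Filter.atTop) → ∃ η₀ : ℝ, 0 < η₀ ∧ ∀ (a₀ θ₀ : Literature.MathematicalPhysics.KineticTheory.T3 → ℝ) (u₀ : Literature.MathematicalPhysics.KineticTheory.T3 → Literature.MathematicalPhysics.KineticTheory.V3), Continuous a₀ → Continuous θ₀ → Continuous u₀ → (∀ x, 0 < a₀ x) → (∀ x, 0 < θ₀ x) → ∃ σ₀ : ℝ, 0 < σ₀ ∧ ∀ σ : ℝ, 0 < σ → σ < σ₀ → ∀ (T : ℝ) (ρ θ : ℝ → Literature.MathematicalPhysics.KineticTheory.T3 → ℝ) (u : ℝ → Literature.MathematicalPhysics.KineticTheory.T3 → Literature.MathematicalPhysics.KineticTheory.V3), Literature.MathematicalPhysics.KineticTheory.IsHardSphereEulerSolution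 σ T ρ u θ → (∀ t ∈ Set.Ico 0 T, ∀ x, ρ t x * σ ^ 3 < η₀) → (∫ x, ρ 0 x = 1) → ∀ (Q R : (N : ℕ) → ℝ → MeasureTheory.Measure (Literature.Analysis.FluidPDE.Config (N + 1) (Fin 3) Literature.MathematicalPhysics.KineticTheory.T3)), Q = (fun N t => Literature.MathematicalPhysics.KineticTheory.kernelGasLawAt (κ N) (Literature.Analysis.FluidPDE.Torus.geometry (Fin 3)) (Literature.MathematicalPhysics.KineticTheory.hsDiameter σ N) (N + 1) ((Literature.Analysis.FluidPDE.liouville (Literature.Analysis.FluidPDE.Torus.geometry (Fin 3)) (N + 1) (Literature.MathematicalPhysics.KineticTheory.hsDiameter σ N)).withDensity (fun z => ENNReal.ofReal (Literature.Analysis.FluidPDE.canonicalDensity (Literature.Analysis.FluidPDE.Torus.geometry (Fin 3)) (Literature.MathematicalPhysics.KineticTheory.hsDiameter σ N) (N + 1) (Literature.MathematicalPhysics.KineticTheory.localGibbsProfile a₀ u₀ θ₀) z))) t) → R = (fun N t => (Literature.Analysis.FluidPDE.liouville (Literature.Analysis.FluidPDE.Torus.geometry (Fin 3)) (N + 1)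 (Literature.MathematicalPhysics.KineticTheory.hsDiameter σ N)).withDensity (fun z => ENNReal.ofReal (Literature.Analysis.FluidPDE.canonicalDensity (Literature.Analysis.FluidPDE.Torus.geometry (Fin 3)) (Literature.MathematicalPhysics.KineticTheory.hsDiameter σ N) (N + 1) (Literature.MathematicalPhysics.KineticTheory.localGibbsProfile (fun x => ρ t x * Real.exp (Literature.MathematicalPhysics.KineticTheory.hsExcessFreeEnergy (ρ t x * σ ^ 3) + Literature.MathematicalPhysics.KineticTheory.hsCompressibility (ρ t x * σ ^ 3) - 1)) (u t) (θ t)) z))) → Filter.Tendsto (fun N : ℕ => InformationTheory.klDiv (Q N 0) (R N 0) / ((N : ENNReal) + 1)) Filter.atTop (nhds 0) → ∀ t ∈ Set.Ico 0 T, Filter.Tendsto (fun N : ℕ => InformationTheory.klDiv (Q N t) (R N t) / ((N : ENNReal) + 1)) Filter.atTop (nhds 0) := by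
  sorry

/-- STUB T · ENTROPY ⇒ CONCENTRATION TRANSFER (information theory; size M; provable now). For finite
measures `μ_N` and probability measures `ν_N` on arbitrary measurable spaces with specific relative entropy
`klDiv μ_N ν_N / (N+1) → 0`, every sequence of events that is exponentially rare under `ν_N`,
`ν_N(A_N) ≤ C e^{-(N+1)/C}`, is asymptotically null under `μ_N`. Why plausibly true: the entropy inequality
`μ(A) ≤ (H(μ̄|ν) + log 2)/log(1 + 1/ν(A))` for the normalised `μ̄` and
`H(μ|ν) = m H(μ̄|ν) + m log m + 1 − m ≥ max(m H(μ̄|ν), m − e²)` for `m = μ(univ)` (Mathlib's `klDiv` carries the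
mass correction), so `μ(A) ≤ (H(μ|ν) + m log 2)/((N+1)/C − log C)` with `m = O(H(μ|ν)) + O(1) = o(N)`;
non-measurable `A_N` are handled by a measurable hull of equal `ν_N`-measure. Why it might fail: it does
not — this is the classical Csiszár / Donsker–Varadhan step of Cor. 2.2; the only care is Mathlib's
`klDiv = ∞` branch (then the hypothesis fails) and unnormalised `μ_N`. Leans on: `InformationTheory.klDiv`,
`MeasureTheory.Measure.rnDeriv`, `exists_measurable_superset`. Sources: KipnisLandim1999 App. 1.8,
OllaVaradhanYau1993 Cor 2.2, Yau1991. -/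
theorem stub_entropyConcentrationTransfer :
    ∀ (Ω : ℕ → Type) [∀ N, MeasurableSpace (Ω N)] (μ ν : (N : ℕ) → MeasureTheory.Measure (Ω N)), (∀ N, MeasureTheory.IsFiniteMeasure (μ N)) → (∀ N, MeasureTheory.IsProbabilityMeasure (ν N)) → Filter.Tendsto (fun N : ℕ => InformationTheory.klDiv (μ N) (ν N) / ((N : ENNReal) + 1)) Filter.atTop (nhds 0) → ∀ A : (N : ℕ) → Set (Ω N), (∃ C : ℝ, 0 < C ∧ ∀ N : ℕ, ν N (A N) ≤ ENNReal.ofReal (C * Real.exp (-(C⁻¹ * ((N : ℝ) + 1))))) → Filter.Tendsto (fun N : ℕ => μ N (A N)) Filter.atTop (nhds 0) := by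
  sorry

/-! ## Name-keyed aliases of the stub statements (the hypotheses of the composition) -/

namespace Registered

/-- Alias of the statement of `stub_diluteReferenceLD` (by `type_of%`, so alias = statement). -/
abbrev stub_diluteReferenceLD : Prop :=
  type_of% @_root_.Summit.AtomisticToContinuum.HydrodynamicLimit.Cruxes.KernelGasEulerLimit.Birth.stub_diluteReferenceLD
/-- Alias of the statement of `stub_initialEntropy`. -/
abbrev stub_initialEntropy : Prop :=
  type_of% @_root_.Summit.AtomisticToContinuum.HydrodynamicLimit.Cruxes.KernelGasEulerLimit.Birth.stub_initialEntropy
/-- Alias of the statement of `stub_kernelEntropyGronwall`. -/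
abbrev stub_kernelEntropyGronwall : Prop :=
  type_of% @_root_.Summit.AtomisticToContinuum.HydrodynamicLimit.Cruxes.KernelGasEulerLimit.Birth.stub_kernelEntropyGronwall
/-- Alias of the statement of `stub_entropyConcentrationTransfer`. -/
abbrev stub_entropyConcentrationTransfer : Prop :=
  type_of% @_root_.Summit.AtomisticToContinuum.HydrodynamicLimit.Cruxes.KernelGasEulerLimit.Birth.stub_entropyConcentrationTransfer

end Registered

/-! ## Proof-local abbreviations and two measure-theoretic helper lemmas (NOT used in stub signatures) -/

section Helpers

open Literature.MathematicalPhysics.KineticTheory Literature.Analysis.FluidPDE ProbabilityTheory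

/-- (proof-local) The flow-free sphere local Gibbs law with activity `a`, velocity `w`, temperature `ϑ` at
reduced diameter `σ`, `N + 1` particles — literally the crux's initial-law expression. -/
noncomputable abbrev refLaw (σ : ℝ) (a : T3 → ℝ) (w : T3 → V3) (ϑ : T3 → ℝ) (N : ℕ) :
    Measure (Config (N + 1) (Fin 3) T3) :=
  (liouville (Torus.geometry (Fin 3)) (N + 1) (hsDiameter σ N)).withDensity fun z =>
    ENNReal.ofReal (canonicalDensity (Torus.geometry (Fin 3)) (hsDiameter σ N) (N + 1) (localGibbsProfile a w ϑ) z)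

/-- (proof-local) The equation-of-state activity `r · exp(f_ex(rσ³) + Z(rσ³) − 1)` of a density profile `r`. -/
noncomputable abbrev eosActivity (σ : ℝ) (r : T3 → ℝ) : T3 → ℝ :=
  fun x => r x * Real.exp (hsExcessFreeEnergy (r x * σ ^ 3) + hsCompressibility (r x * σ ^ 3) - 1)

/-- (proof-local) The time-`t` law of `HS(κ)` started from the sphere local Gibbs law — the crux's `Q N t`. -/
noncomputable abbrev lawQ (K : CollisionKernel (Fin 3)) [IsMarkovKernel K] (σ : ℝ) (a₀ θ₀ : T3 → ℝ)
    (u₀ : T3 → V3) (N : ℕ) (t : ℝ) : Measure (Config (N + 1) (Fin 3) T3) :=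
  kernelGasLawAt K (Torus.geometry (Fin 3)) (hsDiameter σ N) (N + 1) (refLaw σ a₀ u₀ θ₀ N) t

/-- Every canonical law `Z⁻¹ 𝟙_D f₀^{⊗n} dz` of a pair-exclusion geometry is a finite measure (if `Z = 0` the
density is the junk value `0`), hence so is every time-`τ` law of `HS(κ)` started from it (push-forward of
the product with the probability measure `unitDice`). Verbatim the `hfin` step of the route's `closes`. -/
theorem isFiniteMeasure_laws (K : CollisionKernel (Fin 3)) [IsMarkovKernel K]
    (G : Geometry (Fin 3) (UnitAddTorus (Fin 3))) (e : ℝ) (n : ℕ)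
    (f₀ : UnitAddTorus (Fin 3) × EuclideanSpace ℝ (Fin 3) → ℝ) :
    IsFiniteMeasure ((liouville G n e).withDensity fun z => ENNReal.ofReal (canonicalDensity G e n f₀ z)) ∧
      ∀ τ : ℝ, IsFiniteMeasure (kernelGasLawAt K G e n
        ((liouville G n e).withDensity fun z => ENNReal.ofReal (canonicalDensity G e n f₀ z)) τ) := by
  have hint : Integrable (canonicalDensity G e n f₀) volume := by
    unfold canonicalDensity canonicalPartition
    by_cases hI : Integrable ((hardSphereDomain G n e).indicator (tensorPow n f₀)) volume
    · exact hI.const_mul _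
    · rw [integral_undef hI, inv_zero]
      simp only [zero_mul]
      exact integrable_zero _ _ _
  rw [liouville_eq]
  have h1 := isFiniteMeasure_withDensity_ofReal
    (hint.restrict (s := hardSphereDomain G n e)).hasFiniteIntegral
  exact ⟨h1, fun τ => by
    unfold kernelGasLawAt
    infer_instance⟩

/-- On the flat torus with `ε < 1/2` the time maps of `HS(κ)` are measurable, so every time-`s` law has the
total mass of `P₀ ⊗ unitDice`; in particular `Q_s(A) ≤ Q_{s'}(univ)`. -/
theorem kernelGasLawAt_le_univ (K : CollisionKernel (Fin 3)) [IsMarkovKernel K] {e : ℝ} (he : e < 2⁻¹)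
    (n : ℕ) (P₀ : Measure (Config n (Fin 3) (UnitAddTorus (Fin 3)))) (s s' : ℝ)
    (A : Set (Config n (Fin 3) (UnitAddTorus (Fin 3)))) :
    kernelGasLawAt K (Torus.geometry (Fin 3)) e n P₀ s A ≤
      kernelGasLawAt K (Torus.geometry (Fin 3)) e n P₀ s' Set.univ := by
  have h : ∀ r : ℝ, kernelGasLawAt K (Torus.geometry (Fin 3)) e n P₀ r Set.univ = (P₀.prod unitDice) Set.univ :=
    fun r => by
      unfold kernelGasLawAt
      rw [Measure.map_apply (measurable_stochasticCollisionHardSphereProcess_torus K he n r) MeasurableSet.univ,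
        Set.preimage_univ]
  calc kernelGasLawAt K (Torus.geometry (Fin 3)) e n P₀ s A
      ≤ kernelGasLawAt K (Torus.geometry (Fin 3)) e n P₀ s Set.univ := measure_mono (Set.subset_univ _)
    _ = kernelGasLawAt K (Torus.geometry (Fin 3)) e n P₀ s' Set.univ := by rw [h s, h s']

end Helpers

/-! ## The composition: the four stubs conclude the crux BY NAME (real proof, no `sorry`) -/

section Composition

open Literature.MathematicalPhysics.KineticTheory Literature.Analysis.FluidPDE ProbabilityTheory

/-- **`KernelGasEulerLimit` from the line S · I · D · T.** Thresholds `η₀ := min ηS (min ηI ηD)` and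
`σ₀ := min (1/2) (min σI σD)`. If the Euler datum is normalised (`∫ρ₀ = 1`): S gives, at the time `t`, the
reference laws `R N t` (probability, exponentially concentrated around the Euler fields), I the vanishing
initial specific entropy, D its propagation to time `t`, and T converts `klDiv (Q N t) (R N t) = o(N)` plus
exponential concentration into the three convergence-in-probability statements. If `∫ρ₀ ≠ 1`, the initial
LLN tested against `χ ≡ 1` forces the total mass of `Q N 0` to vanish, which dominates every `Q N t (A)`
(measurability of the `HS(κ)` time maps on the torus, `ε_N ≤ σ < 1/2`). -/
theorem KernelGasEulerLimit_of :
    Registered.stub_diluteReferenceLD → Registered.stub_initialEntropy →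
      Registered.stub_kernelEntropyGronwall → Registered.stub_entropyConcentrationTransfer →
      Summit.AtomisticToContinuum.HydrodynamicLimit.Theses.GolfBallDice.KernelGasEulerLimit := by
  intro hS hI hD hT κ hκM q hκ
  obtain ⟨ηS, hηS, HS⟩ := hS
  obtain ⟨ηI, hηI, HI⟩ := hI
  obtain ⟨ηD, hηD, HD⟩ := @hD κ hκM q hκ
  refine ⟨min ηS (min ηI ηD), lt_min hηS (lt_min hηI hηD), ?_⟩
  intro a₀ θ₀ u₀ ha hθ hu ha0 hθ0
  obtain ⟨σI, hσI, HI'⟩ := @HI κ hκM a₀ θ₀ u₀ ha hθ hu ha0 hθ0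
  obtain ⟨σD, hσD, HD'⟩ := HD a₀ θ₀ u₀ ha hθ hu ha0 hθ0
  refine ⟨min (1 / 2) (min σI σD), lt_min one_half_pos (lt_min hσI hσD), ?_⟩
  intro σ hσ hσlt
  obtain ⟨hσ2, hσID⟩ := lt_min_iff.1 hσlt
  obtain ⟨hσI', hσD'⟩ := lt_min_iff.1 hσID
  dsimp only
  intro T ρ θ u hsol hband h0 t ht
  have hT0 : 0 < T := ht.1.trans_lt ht.2
  have h0T : (0 : ℝ) ∈ Set.Ico 0 T := ⟨le_rfl, hT0⟩
  have hε : ∀ N : ℕ, hsDiameter σ N < 2⁻¹ := fun N =>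
    (hsDiameter_le hσ.le N).trans_lt (hσ2.trans_eq (one_div 2))
  have hF := fun (N : ℕ) (f₀ : UnitAddTorus (Fin 3) × EuclideanSpace ℝ (Fin 3) → ℝ) =>
    isFiniteMeasure_laws (κ N) (Torus.geometry (Fin 3)) (hsDiameter σ N) (N + 1) f₀
  by_cases hmass : ∫ x, ρ 0 x = 1
  · -- normalised datum: S · I · D · T
    have hbandS : ∀ s ∈ Set.Ico 0 T, ∀ x, ρ s x * σ ^ 3 < ηS := fun s hs x =>
      (hband s hs x).trans_le (min_le_left _ _)
    have hbandI : ∀ x, ρ 0 x * σ ^ 3 < ηI := fun x =>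
      (hband 0 h0T x).trans_le ((min_le_right _ _).trans (min_le_left _ _))
    have hbandD : ∀ s ∈ Set.Ico 0 T, ∀ x, ρ s x * σ ^ 3 < ηD := fun s hs x =>
      (hband s hs x).trans_le ((min_le_right _ _).trans (min_le_right _ _))
    have hSt := HS σ T ρ θ u hσ hσ2.le hsol hbandS hmass _ rfl t ht
    obtain ⟨hRprob, hRconc⟩ := hSt
    have hRprob' : ∀ N : ℕ, IsProbabilityMeasure (refLaw σ (eosActivity σ (ρ t)) (u t) (θ t) N) := hRprob
    have hI0 := HI' σ hσ hσI' T ρ θ u hsol hT0 hbandI _ _ rfl rfl h0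
    have hDt : Filter.Tendsto (fun N : ℕ => InformationTheory.klDiv (lawQ (κ N) σ a₀ θ₀ u₀ N t)
        (refLaw σ (eosActivity σ (ρ t)) (u t) (θ t) N) / ((N : ENNReal) + 1)) Filter.atTop (nhds 0) :=
      HD' σ hσ hσD' T ρ θ u hsol hbandD hmass _ _ rfl rfl hI0 t ht
    have hTt := hT (fun N => Config (N + 1) (Fin 3) T3) (fun N => lawQ (κ N) σ a₀ θ₀ u₀ N t)
      (fun N => refLaw σ (eosActivity σ (ρ t)) (u t) (θ t) N) (fun N => (hF N _).2 t) hRprob' hDt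
    intro χ hχ δ hδ
    obtain ⟨C, hC, hCN⟩ := hRconc χ hχ δ hδ
    exact ⟨hTt _ ⟨C, hC, fun N => (hCN N).1⟩, hTt _ ⟨C, hC, fun N => (hCN N).2.1⟩,
      hTt _ ⟨C, hC, fun N => (hCN N).2.2⟩⟩
  · -- unnormalised datum: the initial law has asymptotically vanishing total mass
    have hpos : 0 < |1 - ∫ x, ρ 0 x| := abs_pos.2 (sub_ne_zero.2 (Ne.symm hmass))
    have key : ∀ (N : ℕ) (z : Config (N + 1) (Fin 3) T3),
        |1 - ∫ x, ρ 0 x| / 2 <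
          |empiricalDensityField z (fun _ => (1 : ℝ)) - ∫ x, (fun _ => (1 : ℝ)) x * ρ 0 x| := by
      intro N z
      rw [empiricalDensityField_one (Nat.succ_ne_zero N) z]
      simp only [one_mul]
      exact half_lt_self hpos
    have h0' := (h0 (fun _ => (1 : ℝ)) continuous_const _ (half_pos hpos)).1
    have hmass0 : Filter.Tendsto (fun N : ℕ => lawQ (κ N) σ a₀ θ₀ u₀ N 0 Set.univ) Filter.atTop (nhds 0) :=
      tendsto_of_tendsto_of_tendsto_of_le_of_le tendsto_const_nhds h0' (fun _ => bot_le)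
        (fun N => measure_mono fun z _ => key N z)
    intro χ hχ δ hδ
    refine ⟨?_, ?_, ?_⟩ <;>
      exact tendsto_of_tendsto_of_tendsto_of_le_of_le tendsto_const_nhds hmass0 (fun _ => bot_le)
        (fun N => kernelGasLawAt_le_univ (κ N) (hε N) (N + 1) _ t 0 _)

end Composition

/-- Hypothesis-free form (type-checks that the verbatim stub statements are definitionally the named
`Registered.*` hypotheses of `KernelGasEulerLimit_of`; inherits the stubs' `sorry`s, states nothing new). -/
example : Summit.AtomisticToContinuum.HydrodynamicLimit.Theses.GolfBallDice.KernelGasEulerLimit :=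
  KernelGasEulerLimit_of stub_diluteReferenceLD stub_initialEntropy stub_kernelEntropyGronwall
    stub_entropyConcentrationTransfer

end Summit.AtomisticToContinuum.HydrodynamicLimit.Cruxes.KernelGasEulerLimit.Birth
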